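import Literature.Analysis.UnboundedOperators.DiagonalOperatorCompact   -- ★ `HilbertBasis.isCompactOperator_diagonalCLM_of_tendsto_zero`, ★ `HilbertBasis.diagonalCLM_basis`
import Mathlib.Analysis.InnerProductSpace.l2Space
import Mathlib.Analysis.InnerProductSpace.Projection.Submodule
import Mathlib.Topology.Algebra.Module.ContinuousLinearMap.Restrict
import Mathlib.Topology.Order.LiminfLimsup
import HarnessLib

/-!
# K2·E1 — RUNG 1 of the payer programme of `sig_K2E1ResidualCompactU2`: an operator acting by NULL SCALARS on an
# orthogonal family of lines is COMPACT on their closed span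

Cell `hodgecm-mathlib`, Track B ∕ K2-LIT, squad K2, ENGINE E1 (line `K2_E1_TraceFormulaBeta`, socket module
`K2_E1_TraceFormulaBetaSigs_GlobalIndex`, live socket `sig_K2E1ResidualCompactU2` :243 = ★ `CmResidualSpectrumCompact L 2 μ`);
crux H413 = `stmt-HodgeConjecture-24833` (route `HCCMUnconditional`); seat K2E1-p09 (g2), DEAL K2E1-plan (g0) 2026-09-03T23:07:35Z.
Lane `--supports stmt-HodgeConjecture-24833 --as helper`: PURE functional analysis (Mathlib + the tree's ★
`Literature/Analysis/UnboundedOperators/DiagonalOperatorCompact`), no definition, no instance, no named fact, no `sorry`.  Closes no socket.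
HONEST LABEL: HC_CM is proved only modulo the 7 printed citations (2 remaining named inputs: hLiu418 = `stmt-HodgeConjecture-24832`,
h413 = `stmt-HodgeConjecture-24833`) until rung 0 closes; nothing here changes that count.

PRINT SHAPE being served [MoeglinWaldspurger1995, I.2.18; Rogawski1990, §11.2, §13.5]: the residual spectrum `L²_res(U(Φ₂))` is the closed
span of the pairwise orthogonal LINES `ℂ·(χ∘det)`, on each of which `R(f)` acts by the scalar `f̂(χ) = ∫ f(g) χ(det g) dη(g)`, and `f̂(χ) → 0`
along the characters (Riemann–Lebesgue, rung 2).  This file is the abstract operator-theoretic rung: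

* §0 the null condition: `Tendsto c cofinite (𝓝 0) ↔ ∀ ε > 0, {k | ε ≤ ‖c k‖}` finite (`tendsto_cofinite_zero_iff`), and it makes `c` a bounded
  symbol (`memℓp_top_of_tendsto_cofinite_zero`);
* §1 CORE (`isCompactOperator_of_hilbertBasis_eigen`): a bounded operator `S` on a Hilbert space `W` with a Hilbert basis `b` of EIGENVECTORS,
  `S (b k) = c k • b k`, `c → 0` cofinitely, IS the ★ diagonal operator `b.diagonalCLM c` (`eq_diagonalCLM_of_apply_basis`: bounded operators
  agreeing on a Hilbert basis agree), hence COMPACT by ★ `HilbertBasis.isCompactOperator_diagonalCLM_of_tendsto_zero` (Halmos, Problem 171;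
  [ReedSimonI1980, Thm. VI.12–VI.13]: norm limits of finite-rank truncations);
* §2 a CLOSED subspace `W` of a Hilbert space `E` SANDWICHED between an orthonormal family `e` and its closed span (`e k ∈ W ≤ closure (span e)`)
  carries a Hilbert basis with underlying vectors `e` (`exists_hilbertBasis_coe_eq`) — the form in which `L²_res` meets the lines;
* §3 CONSUMER SHAPES: for such `W` and `T : E →L[𝕜] E` with `T (e k) = c k • e k`, `c → 0`: `IsCompactOperator (fun w : W => T w)` — LITERALLY the
  shape of ★ `ResidualSpectrumCompact` («`fun w : L²_res => R(f) (w : L²)`») — and the endomorphism form `S : W →L[𝕜] W`;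
* §4 the same for a merely ORTHOGONAL family of NON-ZERO vectors `v k` (the functions `χ∘det` have norm `√vol`, not `1`), by normalising.

References: P. R. Halmos, *A Hilbert Space Problem Book*, Problem 171 [folklore]; [ReedSimonI1980] Thm. VI.12–VI.13;
[MoeglinWaldspurger1995] C. Mœglin, J.-L. Waldspurger, *Spectral decomposition and Eisenstein series*, I.2.18; [Rogawski1990] §13.5 pp. 204–206.
-/

set_option autoImplicit false
-- the mandated namespace has the single-problem summit's repeated segment (`HodgeConjecture.HodgeConjecture`)
set_option linter.dupNamespace false

noncomputable section

namespace Summit.HodgeConjecture.HodgeConjecture.Cruxes.H413.K2E1DiagonalCharacterOperatorCompact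

open Filter Topology Submodule
open scoped InnerProductSpace

variable {𝕜 : Type*} [RCLike 𝕜]

/-! ## §0 The null condition on the eigenvalues -/

/-- **The null condition, ε-form**: `c k → 0` along the cofinite filter iff for every `ε > 0` only finitely many `k` have `ε ≤ ‖c k‖`
(the form in which Riemann–Lebesgue delivers it character by character). [folklore] -/
theorem tendsto_cofinite_zero_iff {κ : Type*} (c : κ → 𝕜) :
    Tendsto c cofinite (𝓝 0) ↔ ∀ ε : ℝ, 0 < ε → {k | ε ≤ ‖c k‖}.Finite := by
  rw [Metric.tendsto_nhds]
  refine forall_congr' fun ε => forall_congr' fun _ => ?_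
  simp only [dist_zero_right, eventually_cofinite, not_lt]

/-- A cofinitely null family of scalars is BOUNDED, i.e. a symbol in `ℓ^∞` (so that the ★ bounded diagonal operator `diagonalCLM` is available).
[folklore] -/
theorem memℓp_top_of_tendsto_cofinite_zero {κ : Type*} {c : κ → 𝕜} (hc : Tendsto c cofinite (𝓝 0)) :
    Memℓp c ⊤ :=
  memℓp_infty hc.norm.bddAbove_range_of_cofinite

/-! ## §1 Core: an operator with a Hilbert basis of eigenvectors and null eigenvalues is compact -/

section Core

variable {κ : Type*} {W : Type*} [NormedAddCommGroup W] [InnerProductSpace 𝕜 W]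

/-- **Bounded operators agreeing on a Hilbert basis agree**; in particular an operator acting on the Hilbert basis `b` by the bounded scalars `m`
IS the ★ diagonal operator `b.diagonalCLM m` (dense span of the basis, ★ `HilbertBasis.dense_span`, and `ContinuousLinearMap.ext_on`).
[folklore] -/
theorem eq_diagonalCLM_of_apply_basis (b : HilbertBasis κ 𝕜 W) (m : lp (fun _ : κ => 𝕜) ⊤) (S : W →L[𝕜] W)
    (hS : ∀ k, S (b k) = m k • b k) : S = b.diagonalCLM m :=
  ContinuousLinearMap.ext_on (Submodule.dense_iff_topologicalClosure_eq_top.2 b.dense_span)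
    (by
      rintro _ ⟨k, rfl⟩
      change S (b k) = b.diagonalCLM m (b k)
      rw [hS k, b.diagonalCLM_basis])

/-- **CORE (Halmos, Problem 171; Reed–Simon I, Thm. VI.12–VI.13).**  Let `W` be a Hilbert space with a Hilbert basis `b`, and `S` a bounded operator
with `S (b k) = c k • b k` where `c k → 0` along the cofinite filter.  Then `S` is a COMPACT operator: it is the ★ diagonal operator with the
bounded null symbol `c` (`eq_diagonalCLM_of_apply_basis`), compact by ★ `HilbertBasis.isCompactOperator_diagonalCLM_of_tendsto_zero` (operator-norm
limit of its finite-rank truncations). [cite: ReedSimonI1980, Thm. VI.12–VI.13] -/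
theorem isCompactOperator_of_hilbertBasis_eigen [CompleteSpace W] (b : HilbertBasis κ 𝕜 W) (S : W →L[𝕜] W) (c : κ → 𝕜)
    (hS : ∀ k, S (b k) = c k • b k) (hc : Tendsto c cofinite (𝓝 0)) : IsCompactOperator S := by
  let m : lp (fun _ : κ => 𝕜) ⊤ := ⟨c, memℓp_top_of_tendsto_cofinite_zero hc⟩
  have hm : ∀ k, m k = c k := fun _ => rfl
  rw [eq_diagonalCLM_of_apply_basis b m S (fun k => by rw [hm, hS])]
  refine b.isCompactOperator_diagonalCLM_of_tendsto_zero m ?_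
  have h := hc.norm
  rw [norm_zero] at h
  simpa only [hm] using h

end Core

/-! ## §2 A closed subspace sandwiched between an orthonormal family and its closed span has that family as a Hilbert basis -/

section Ambient

variable {κ : Type*} {E : Type*} [NormedAddCommGroup E] [InnerProductSpace 𝕜 E] [CompleteSpace E]

/-- **Hilbert basis of a sandwiched closed subspace.**  If `e` is an orthonormal family in a Hilbert space `E` and `W` is a CLOSED subspace with
`e k ∈ W` for all `k` and `W ≤ closure (span e)`, then `W` has a Hilbert basis whose underlying vectors are the `e k` (a vector of `W` orthogonal to
every `e k` is orthogonal to `span e`, hence to its closure `(span e)ᗮᗮ ∋` itself, so it is `0`; Mathlib `HilbertBasis.mkOfOrthogonalEqBot`).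
[cite: ReedSimonI1980, Thm. II.6] -/
theorem exists_hilbertBasis_coe_eq {e : κ → E} (he : Orthonormal 𝕜 e) {W : Submodule 𝕜 E} (hWc : IsClosed (W : Set E))
    (heW : ∀ k, e k ∈ W) (hW : W ≤ (span 𝕜 (Set.range e)).topologicalClosure) :
    ∃ b : HilbertBasis κ 𝕜 W, ∀ k, (b k : E) = e k := by
  haveI : CompleteSpace W := hWc.isComplete.completeSpace_coe
  let v : κ → W := fun k => ⟨e k, heW k⟩
  have hv : Orthonormal 𝕜 v := he.codRestrict W heW
  have hbot : (span 𝕜 (Set.range v))ᗮ = ⊥ := by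
    rw [Submodule.eq_bot_iff]
    intro w hw
    -- `w ⊥ e k` for every `k`
    have h1 : ∀ k, ⟪e k, (w : E)⟫_𝕜 = 0 := fun k => by
      have h := Submodule.inner_right_of_mem_orthogonal (Submodule.subset_span (Set.mem_range_self k)) hw
      simpa only [Submodule.coe_inner, v] using h
    -- hence `w ∈ (span e)ᗮ`
    have h2 : (w : E) ∈ (span 𝕜 (Set.range e))ᗮ := by
      have hle : span 𝕜 (Set.range e) ≤ (𝕜 ∙ (w : E))ᗮ := by
        refine Submodule.span_le.2 ?_
        rintro _ ⟨k, rfl⟩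
        exact Submodule.mem_orthogonal_singleton_iff_inner_right.2 (inner_eq_zero_symm.1 (h1 k))
      exact Submodule.orthogonal_le hle (Submodule.le_orthogonal_orthogonal (𝕜 ∙ (w : E)) (Submodule.mem_span_singleton_self (w : E)))
    -- and `w ∈ closure (span e) = (span e)ᗮᗮ`
    have h3 : (w : E) ∈ (span 𝕜 (Set.range e))ᗮᗮ := by
      rw [Submodule.orthogonal_orthogonal_eq_closure]
      exact hW w.2
    have h4 : ⟪(w : E), (w : E)⟫_𝕜 = 0 := Submodule.inner_right_of_mem_orthogonal h2 h3
    exact (Submodule.coe_eq_zero.1 (inner_self_eq_zero.1 h4))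
  exact ⟨HilbertBasis.mkOfOrthogonalEqBot hv hbot, fun k => by rw [HilbertBasis.coe_mkOfOrthogonalEqBot]⟩

/-- The CLOSED SPAN of an orthonormal family has that family as a Hilbert basis (the case `W = closure (span e)` of `exists_hilbertBasis_coe_eq`).
[cite: ReedSimonI1980, Thm. II.6] -/
theorem exists_hilbertBasis_topologicalClosure_span {e : κ → E} (he : Orthonormal 𝕜 e) :
    ∃ b : HilbertBasis κ 𝕜 (span 𝕜 (Set.range e)).topologicalClosure, ∀ k, (b k : E) = e k :=
  exists_hilbertBasis_coe_eq he (Submodule.isClosed_topologicalClosure _)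
    (fun k => Submodule.le_topologicalClosure _ (Submodule.subset_span (Set.mem_range_self k))) le_rfl

omit [CompleteSpace E] in
/-- A sandwiched closed subspace IS the closed span: `e k ∈ W ≤ closure (span e)` with `W` closed forces `W = closure (span e)`. [folklore] -/
theorem eq_topologicalClosure_span_of_sandwich {e : κ → E} {W : Submodule 𝕜 E} (hWc : IsClosed (W : Set E))
    (heW : ∀ k, e k ∈ W) (hW : W ≤ (span 𝕜 (Set.range e)).topologicalClosure) :
    W = (span 𝕜 (Set.range e)).topologicalClosure :=
  le_antisymm hW (Submodule.topologicalClosure_minimal _ (Submodule.span_le.2 (by rintro _ ⟨k, rfl⟩; exact heW k)) hWc)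

omit [CompleteSpace E] in
/-- An operator with the `e k` as eigenvectors maps the sandwiched closed subspace `W` into itself (it maps `span e` into itself, hence the closure
into the closure, Mathlib `Submodule.topologicalClosure_map`). [folklore] -/
theorem apply_mem_of_sandwich {e : κ → E} {W : Submodule 𝕜 E} (hWc : IsClosed (W : Set E))
    (heW : ∀ k, e k ∈ W) (hW : W ≤ (span 𝕜 (Set.range e)).topologicalClosure)
    (T : E →L[𝕜] E) (c : κ → 𝕜) (hT : ∀ k, T (e k) = c k • e k) (w : E) (hw : w ∈ W) : T w ∈ W := by
  have hspan : (span 𝕜 (Set.range e)).map (T : E →ₗ[𝕜] E) ≤ span 𝕜 (Set.range e) := by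
    rw [Submodule.map_span_le]
    rintro _ ⟨k, rfl⟩
    rw [ContinuousLinearMap.coe_coe, hT k]
    exact Submodule.smul_mem _ _ (Submodule.subset_span (Set.mem_range_self k))
  have hcl : T w ∈ (span 𝕜 (Set.range e)).topologicalClosure :=
    ((Submodule.topologicalClosure_map T _).trans (Submodule.topologicalClosure_mono hspan)) ⟨w, hW hw, rfl⟩
  rw [eq_topologicalClosure_span_of_sandwich hWc heW hW]
  exact hcl

/-! ## §3 Consumer shapes: compactness of `w ↦ T w` on the sandwiched closed subspace, and of an endomorphism of it -/

/-- **ENDOMORPHISM FORM.**  `W` a closed subspace of a Hilbert space `E` with `e k ∈ W ≤ closure (span e)` for an orthonormal family `e`; `S : W →L W`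
with `S (e k) = c k • e k` (as vectors of `E`) and `c → 0` cofinitely.  Then `S` is compact (§1 in the Hilbert basis of §2).
[cite: ReedSimonI1980, Thm. VI.12–VI.13] -/
theorem isCompactOperator_endo_of_orthonormal_eigen {e : κ → E} (he : Orthonormal 𝕜 e) {W : Submodule 𝕜 E}
    (hWc : IsClosed (W : Set E)) (heW : ∀ k, e k ∈ W) (hW : W ≤ (span 𝕜 (Set.range e)).topologicalClosure)
    (S : W →L[𝕜] W) (c : κ → 𝕜) (hS : ∀ k, (S ⟨e k, heW k⟩ : E) = c k • e k) (hc : Tendsto c cofinite (𝓝 0)) :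
    IsCompactOperator S := by
  haveI : CompleteSpace W := hWc.isComplete.completeSpace_coe
  obtain ⟨b, hb⟩ := exists_hilbertBasis_coe_eq he hWc heW hW
  refine isCompactOperator_of_hilbertBasis_eigen b S c (fun k => ?_) hc
  have hbk : b k = ⟨e k, heW k⟩ := Subtype.ext (hb k)
  apply Subtype.ext
  rw [hbk, hS k, Submodule.coe_smul]

/-- **THE SHAPE OF ★ `ResidualSpectrumCompact`.**  `W` a closed subspace of a Hilbert space `E` with `e k ∈ W ≤ closure (span e)` for an orthonormal family
`e`; `T : E →L[𝕜] E` with `T (e k) = c k • e k` and `c k → 0` along the cofinite filter.  Then `w ↦ T w` is a COMPACT operator `W → E` (it is the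
inclusion `W ↪ E` after the compact endomorphism `T|_W` of `isCompactOperator_endo_of_orthonormal_eigen`, Mathlib `IsCompactOperator.clm_comp`).
For `E = L²`, `W = L²_res(U(Φ₂))`, `e` = the normalised `χ∘det`, `T = R(f)`, `c k = f̂(χ_k)` this is `R(f)|_{L²_res}` compact.
[cite: ReedSimonI1980, Thm. VI.12–VI.13] [cite: MoeglinWaldspurger1995, I.2.18] -/
theorem isCompactOperator_apply_coe_of_orthonormal_eigen {e : κ → E} (he : Orthonormal 𝕜 e) {W : Submodule 𝕜 E}
    (hWc : IsClosed (W : Set E)) (heW : ∀ k, e k ∈ W) (hW : W ≤ (span 𝕜 (Set.range e)).topologicalClosure)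
    (T : E →L[𝕜] E) (c : κ → 𝕜) (hT : ∀ k, T (e k) = c k • e k) (hc : Tendsto c cofinite (𝓝 0)) :
    IsCompactOperator (fun w : W => T w) := by
  have hmaps : ∀ w : W, (T.comp W.subtypeL) w ∈ W := fun w => apply_mem_of_sandwich hWc heW hW T c hT w w.2
  set S : W →L[𝕜] W := (T.comp W.subtypeL).codRestrict W hmaps with hSdef
  have hS : ∀ k, (S ⟨e k, heW k⟩ : E) = c k • e k := fun k => by
    rw [hSdef, ContinuousLinearMap.coe_codRestrict_apply]
    exact hT k
  have hSc : IsCompactOperator S := isCompactOperator_endo_of_orthonormal_eigen he hWc heW hW S c hS hc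
  have hcomp := hSc.clm_comp W.subtypeL
  have hfun : (⇑W.subtypeL ∘ ⇑S) = fun w : W => T w := by
    funext w
    rw [Function.comp_apply, Submodule.subtypeL_apply, hSdef, ContinuousLinearMap.coe_codRestrict_apply]
    rfl
  rwa [hfun] at hcomp

/-- The dealer's phrasing: for an orthonormal family `e` of a Hilbert space `E`, `T (e k) = c k • e k`, `c → 0` cofinitely, the restriction of `T` to the
CLOSED SPAN `W := closure (span e)` — `T ∘L W.subtypeL : W →L[𝕜] E` — is a compact operator. [cite: ReedSimonI1980, Thm. VI.12–VI.13] -/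
theorem isCompactOperator_comp_subtypeL_topologicalClosure_span {e : κ → E} (he : Orthonormal 𝕜 e)
    (T : E →L[𝕜] E) (c : κ → 𝕜) (hT : ∀ k, T (e k) = c k • e k) (hc : Tendsto c cofinite (𝓝 0)) :
    IsCompactOperator (T.comp (span 𝕜 (Set.range e)).topologicalClosure.subtypeL) :=
  isCompactOperator_apply_coe_of_orthonormal_eigen he (Submodule.isClosed_topologicalClosure _)
    (fun k => Submodule.le_topologicalClosure _ (Submodule.subset_span (Set.mem_range_self k))) le_rfl T c hT hc

/-! ## §4 Orthogonal families of non-zero (not necessarily unit) vectors: the lines `ℂ·(χ∘det)` -/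

omit [CompleteSpace E] in
/-- NORMALISATION: an orthogonal family of non-zero vectors becomes orthonormal after dividing by the norms. [folklore] -/
theorem orthonormal_normalise {v : κ → E} (hv0 : ∀ k, v k ≠ 0) (hvo : Pairwise fun k l => ⟪v k, v l⟫_𝕜 = 0) :
    Orthonormal 𝕜 (fun k => ((‖v k‖⁻¹ : ℝ) : 𝕜) • v k) := by
  classical
  rw [orthonormal_iff_ite]
  intro i j
  rw [inner_smul_left, inner_smul_right, RCLike.conj_ofReal]
  split_ifs with h
  · subst h
    rw [inner_self_eq_norm_sq_to_K]
    have hn : (‖v i‖ : 𝕜) ≠ 0 := by exact_mod_cast norm_ne_zero_iff.2 (hv0 i)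
    push_cast
    field_simp
  · rw [hvo h, mul_zero, mul_zero]

omit [CompleteSpace E] in
/-- The normalised family spans the same subspace. [folklore] -/
theorem span_normalise_eq {v : κ → E} (hv0 : ∀ k, v k ≠ 0) :
    span 𝕜 (Set.range fun k => ((‖v k‖⁻¹ : ℝ) : 𝕜) • v k) = span 𝕜 (Set.range v) := by
  refine Submodule.span_eq_span ?_ ?_
  · rintro _ ⟨k, rfl⟩
    exact Submodule.smul_mem _ _ (Submodule.subset_span (Set.mem_range_self k))
  · rintro _ ⟨k, rfl⟩
    have hc : ((‖v k‖⁻¹ : ℝ) : 𝕜) ≠ 0 := by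
      exact_mod_cast inv_ne_zero (norm_ne_zero_iff.2 (hv0 k))
    have hk : v k = (((‖v k‖⁻¹ : ℝ) : 𝕜))⁻¹ • ((((‖v k‖⁻¹ : ℝ) : 𝕜)) • v k) := (inv_smul_smul₀ hc (v k)).symm
    rw [hk]
    exact Submodule.smul_mem _ _ (Submodule.subset_span (Set.mem_range_self k))

omit [CompleteSpace E] in
/-- Eigen-relations survive normalisation: `T (v k) = c k • v k` gives the same relation for `‖v k‖⁻¹ • v k`. [folklore] -/
theorem apply_normalise_eq {v : κ → E} (T : E →L[𝕜] E) (c : κ → 𝕜) (hT : ∀ k, T (v k) = c k • v k) (k : κ) :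
    T (((‖v k‖⁻¹ : ℝ) : 𝕜) • v k) = c k • (((‖v k‖⁻¹ : ℝ) : 𝕜) • v k) := by
  rw [ContinuousLinearMap.map_smul, hT k, smul_comm]

/-- **THE SHAPE OF ★ `ResidualSpectrumCompact`, FOR LINES.**  Let `v k` be pairwise ORTHOGONAL NON-ZERO vectors of a Hilbert space `E` (e.g. the functions
`χ∘det ∈ L²`), `W` a CLOSED subspace with `v k ∈ W ≤ closure (span v)` (e.g. `L²_res(U(Φ₂))`, by Langlands' description of the residual spectrum), and
`T : E →L[𝕜] E` acting on each line by a scalar, `T (v k) = c k • v k` (e.g. `R(f) (χ∘det) = f̂(χ) · χ∘det`), with `c k → 0` along the cofinite filter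
(Riemann–Lebesgue).  Then `w ↦ T w : W → E` is a COMPACT operator. [cite: ReedSimonI1980, Thm. VI.12–VI.13] [cite: MoeglinWaldspurger1995, I.2.18] -/
theorem isCompactOperator_apply_coe_of_orthogonal_eigenlines {v : κ → E} (hv0 : ∀ k, v k ≠ 0)
    (hvo : Pairwise fun k l => ⟪v k, v l⟫_𝕜 = 0) {W : Submodule 𝕜 E} (hWc : IsClosed (W : Set E)) (hvW : ∀ k, v k ∈ W)
    (hW : W ≤ (span 𝕜 (Set.range v)).topologicalClosure) (T : E →L[𝕜] E) (c : κ → 𝕜) (hT : ∀ k, T (v k) = c k • v k)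
    (hc : Tendsto c cofinite (𝓝 0)) : IsCompactOperator (fun w : W => T w) := by
  have hW' : W ≤ (span 𝕜 (Set.range fun k => ((‖v k‖⁻¹ : ℝ) : 𝕜) • v k)).topologicalClosure := by
    rw [span_normalise_eq hv0]; exact hW
  exact isCompactOperator_apply_coe_of_orthonormal_eigen (orthonormal_normalise hv0 hvo) hWc
    (fun k => Submodule.smul_mem _ _ (hvW k)) hW' T c (apply_normalise_eq T c hT) hc

/-- **ENDOMORPHISM FORM, FOR LINES**: with `v`, `W`, `c` as in `isCompactOperator_apply_coe_of_orthogonal_eigenlines`, every `S : W →L[𝕜] W` with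
`S (v k) = c k • v k` (as vectors of `E`) is compact — the shape of `R(f)` restricted to `L²_res` as an operator ON `L²_res`.
[cite: ReedSimonI1980, Thm. VI.12–VI.13] -/
theorem isCompactOperator_endo_of_orthogonal_eigenlines {v : κ → E} (hv0 : ∀ k, v k ≠ 0)
    (hvo : Pairwise fun k l => ⟪v k, v l⟫_𝕜 = 0) {W : Submodule 𝕜 E} (hWc : IsClosed (W : Set E)) (hvW : ∀ k, v k ∈ W)
    (hW : W ≤ (span 𝕜 (Set.range v)).topologicalClosure) (S : W →L[𝕜] W) (c : κ → 𝕜)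
    (hS : ∀ k, (S ⟨v k, hvW k⟩ : E) = c k • v k) (hc : Tendsto c cofinite (𝓝 0)) : IsCompactOperator S := by
  have hW' : W ≤ (span 𝕜 (Set.range fun k => ((‖v k‖⁻¹ : ℝ) : 𝕜) • v k)).topologicalClosure := by
    rw [span_normalise_eq hv0]; exact hW
  refine isCompactOperator_endo_of_orthonormal_eigen (orthonormal_normalise hv0 hvo) hWc (fun k => Submodule.smul_mem _ _ (hvW k)) hW' S c
    (fun k => ?_) hc
  have hk : (⟨((‖v k‖⁻¹ : ℝ) : 𝕜) • v k, Submodule.smul_mem _ _ (hvW k)⟩ : W) = ((‖v k‖⁻¹ : ℝ) : 𝕜) • ⟨v k, hvW k⟩ := rfl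
  rw [hk, ContinuousLinearMap.map_smul, Submodule.coe_smul, hS k, smul_comm]

/-- The whole-space case: if the orthogonal non-zero family `v` has DENSE span in `E` and `T (v k) = c k • v k` with `c → 0` cofinitely, then `T` itself
is compact. [cite: ReedSimonI1980, Thm. VI.12–VI.13] -/
theorem isCompactOperator_of_orthogonal_eigenlines_dense {v : κ → E} (hv0 : ∀ k, v k ≠ 0)
    (hvo : Pairwise fun k l => ⟪v k, v l⟫_𝕜 = 0) (hd : (span 𝕜 (Set.range v)).topologicalClosure = ⊤)
    (T : E →L[𝕜] E) (c : κ → 𝕜) (hT : ∀ k, T (v k) = c k • v k) (hc : Tendsto c cofinite (𝓝 0)) :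
    IsCompactOperator T := by
  have hsp : ⊤ ≤ (span 𝕜 (Set.range fun k => ((‖v k‖⁻¹ : ℝ) : 𝕜) • v k)).topologicalClosure := by
    rw [span_normalise_eq hv0, hd]
  refine isCompactOperator_of_hilbertBasis_eigen (HilbertBasis.mk (orthonormal_normalise hv0 hvo) hsp) T c (fun k => ?_) hc
  simp only [HilbertBasis.coe_mk]
  exact apply_normalise_eq T c hT k

end Ambient

end Summit.HodgeConjecture.HodgeConjecture.Cruxes.H413.K2E1DiagonalCharacterOperatorCompact

end
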